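import Mathlib
import HarnessLib
import HarnessLib.Audit
import Summits.Langlands.Statement
import Literature.NumberTheory.GaloisRepresentations.FramedRepBlockSum
import HarnessLib.Audit.Status.Attr

/-!
Route: ImaginaryQuadraticAnchor

# Route ImaginaryQuadraticAnchor — anchor reciprocity at imaginary quadratic fields; reach every
field by weak automorphic induction and relative descent

It suffices to show X = X1 ∧ X2 ∧ X3 over the single anchor class K = imaginary quadratic (totally
complex, [K:ℚ] = 2; every
number field either contains such a K or acquires one by a quadratic extension F ↦ F·K): X1
(ReciprocityImagQuad, the declared
RESIDUAL) = both directions of GL_n reciprocity over K itself; X2 (WeakAutomorphicInduction) = weak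
automorphic induction of
L-algebraic cusp forms along an ARBITRARY finite extension L ⊃ K, landing in an equal-slope isobaric
family of L-algebraic cuspidals
over K; X3 (RelativeDescent) = relative descent: an irreducible geometric ρ over L all of whose
induced constituents over K are
automorphic is itself automorphic over L. Three supports are theorem-level junctions: AnchorAssembly
(X1 → X2 → X3 → reciprocity
over every L ⊃ K, by a Rankin–Selberg pole count on the boundary Re s = 1), CMFreeQuadraticPatch
(fields with no imaginary quadratic
subfield, by quadratic base change F·K/F over varying K and patching), CanonicalReciprocityData (the
shared local datum item).
Typed from sketch imaginary-quadratic-anchor (markdown wave, reader PASS); kinship declared with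
route-Langlands-BaseFieldAscent
(ReciprocityTRCM ⊇ X1, AscentResidual) and route-Langlands-TwistAveragedDeinduction
(WeakInductionToQ is the ℚ-based sibling of X2).
Lean: `ReciprocityImagQuad ∧ WeakAutomorphicInduction ∧ RelativeDescent`

## Assembly
Pure logic (sorry-free in Sketch.lean and glue.lean): `closes h1 h2 h3 hC hA h0 := h0 (hA h1 h2 h3
hC) hC` — AnchorAssembly turns the
three cruxes into reciprocity over every field containing an imaginary quadratic field,
CMFreeQuadraticPatch adds the CM-free fields using
the canonical local data, and the conclusion is `_root_.Langlands` itself. All six binders are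
load-bearing.

Rationale: WHY THIS LINE. The field variable of `Langlands` is attacked from ONE base where both directions are
within reach of existing machinery: an
imaginary quadratic K is CM (torsion/Shimura methods Scholze2015, HarrisLanTaylorThorneRMS2016,
ACCGHLNSTT2023, CaraianiNewton2023
reach (A)_K; l₀ = 1 derived patching reaches (B)_K), unlike ℚ-anchored siblings whose anchor carries
even/real-place irregularity.
Every other field is reached by two functorialities typed WITHOUT any Galois representation on the
automorphic side: X2 (Ind on the
Galois side is unconditional; its automorphic shadow is asked only WEAKLY, a.e. Satake,
ArthurClozelAMS120 Ch.3 §6, Getz2012Nonsolvable,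
CogdellPiatetskishapiro1999) and X3 (Frobenius reciprocity turns "automorphy of Ind-constituents
over K" into automorphy over L).
The junction is analytic, not Galois-theoretic: Jacquet–Shalika pole orders of partial pair
L-functions at s = 1 (JacquetShalikaAJM1981II,
ArthurClozelAMS120 Ch.3 (2.2)–(2.3)) identify π among the descended constituents, using only
boundary facts already vendored in the tree.
Imported areas: analytic theory of automorphic L-functions (RS/JS), Clifford–Mackey theory of
induced representations, CM patching of
Galois representations over quadratic extensions (ChenevierHarris2013, BlasiusRogawski1993,
HarrisLanTaylorThorneRMS2016). What prior
routes do not do: BaseFieldAscent keeps the whole TR∪CM class as residual and ascends by solvable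
steps; TwistAveragedDeinduction induces
to ℚ (real place, NonRegularWeight core at the anchor) and needs a twist-average extraction lemma;
here the anchor is the smallest CM
class, the extraction is replaced by relative descent + a boundary pole count, and CM-free fields
cost only QUADRATIC base change.

RANKED CRUXES. #2 WeakAutomorphicInduction (crux) — K imaginary quadratic, L ⊃ K any finite
extension, π an L-algebraic cuspidal representation of GL_n(𝔸_L), n ≥ 1: there are L-algebraic
cuspidal P_1..P_r on GL_(m_i)(𝔸_K) (m_i ≥ 1), all of the same real slope σ as π (‖∏ Satake‖ = q^(mσ)
a.e.), whose sum of Satake polynomials at a.e. w equals ∏_(v|w) SatPoly(π_v)(X^f(v|w)) (weak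
automorphic induction, Arthur–Clozel Def. 6.1 shape, along a possibly NON-SOLVABLE L/K). First rung
PROVED in the birth skeleton: the cyclic prime-degree case off the Galois-stable locus, conclusion
truncated to existence + Satake identity, from the vendored fact
automorphicInduction_cyclic_cuspidal (`WeakAutomorphicInduction_rung`); the L-algebraicity/slope
remainder of that case is the plan-only stub `stub_cyclicPrimeCase`. [difficulty: open-problem] (why
it might fail: For L/K with insoluble Galois closure this is non-solvable automorphic induction,
open since 1989; a converse-theorem proof needs twists by BC_(L/K)(τ) for all cuspidal τ on GL_m/K,
m < n[L:K], i.e. non-solvable base change as input.) [ArthurClozelAMS120, Getz2012Nonsolvable,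
GetzHerman2015, CogdellPiatetskishapiro1999, JPSS1983, Rajan1999]
#3 RelativeDescent (crux) — K imaginary quadratic, L ⊃ K finite, ρ : Γ_L → GL_n(ℚ̄_ℓ) irreducible
and geometric (w.r.t. reciprocity data RL): if every irreducible geometric σ : Γ_K → GL_m(ℚ̄_ℓ) such
that ρ is a block summand of σ|Γ_L (equivalently σ ⊂ Ind ρ) corresponds (full local-global
compatibility, data RK) to an L-algebraic cuspidal Π on GL_m(𝔸_K), then ρ corresponds to an
L-algebraic cuspidal π on GL_n(𝔸_L). (Only GEOMETRIC σ are assumed automorphic, so the prover also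
supplies the standard fact that constituents of Ind ρ are de Rham, Fontaine/Brinon–Conrad; the
hypothesis family is non-vacuous by Frobenius reciprocity + semisimplicity of finite-index
restrictions in characteristic 0.) [difficulty: open-problem] (why it might fail: It is non-solvable
base change K → L of the Galois-attached cuspidals Π plus Clifford extraction of one constituent;
for insoluble L/K no trace-formula comparison is available and the local-global clause at places of
L over ramified w must be descended too.) [ArthurClozelAMS120, Getz2012Nonsolvable,
HarrisTaylor2001, HenniartInventiones2000, BarnetlambEtAl2014, BrinonConrad2009]
#4 ReciprocityImagQuad (crux) — GL_n reciprocity (both directions (A) and (B) of the summit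
statement, verbatim, for every reciprocity datum) over every imaginary quadratic field K — the
declared RESIDUAL of the route (special case of the summit; the conjunct NOT attacked here).
[difficulty: open-problem] (why it might fail: It is the summit over imaginary quadratic fields: (A)
needs Galois representations for NON-regular (Maass-type, λ=1/4) L-algebraic π over K with full
monodromy in local-global compatibility; (B) needs automorphy of every irreducible geometric ρ,
incl. residually reducible / Hodge-irregular ones.) [Scholze2015, HarrisLanTaylorThorneRMS2016,
ACCGHLNSTT2023, CaraianiNewton2023, BuzzardGeeLMS2014, CalegariGeraghty2017]
#9 CanonicalReciprocityData (support) — canonical reciprocity data (local Langlands + Fontaine data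
with the canonicity pins) exist for every number field — the shared support item
CanonicalReciprocityData of routes WachComponentCensus / PrimeSwitchSplit (stmt-Langlands-17930),
re-wanted here verbatim. [difficulty: L] (why it might fail: In print (Harris–Taylor, Henniart;
Fontaine) but in the tree only the cite-level `LocalLanglandsDatum.nonempty` with SOME Artin
normalisation; canonicity needs the finite-level reciprocity law for that datum.) [HarrisTaylor2001,
HenniartInventiones2000, BuzzardGeeLMS2014]
#9 AnchorAssembly (support) — X1 → X2 → X3 → CanonicalReciprocityData → reciprocity (both
directions, every datum, every n ≥ 1) over every finite extension L of an imaginary quadratic K (the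
canonical data supply the reciprocity datum over K that X1/X3 are instantiated at). Theorem-level
junction: (B)_L = X3 fed by (B)_K; (A)_L: X2(π) gives P_i, (A)_K gives R = ⊞ ρ_(P_i), the
constituents σ_j of R|Γ_L are geometric (DeRhamBaseChange_holds, isDeRhamFramed_blocks), X3 gives
π_j ↔ σ_j, a second application of X2 to the π_j and the Jacquet–Shalika boundary facts (2.2)–(2.3)
force all slopes equal and then ∏_i L^S(s, P_i × P̃_i') = ∏_j L^S(s, π × π̃_j) has a pole at s = 1,
so π ≅ π_j for some j (strong multiplicity one) and ρ_π := σ_j; uniqueness by Chebotarev +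
Brauer–Nesbitt. [deps: ReciprocityImagQuad, WeakAutomorphicInduction, RelativeDescent,
CanonicalReciprocityData] [difficulty: L] (why it might fail: Long formal junction resting on
vendored-but-unproved analytic facts (JacquetShalika1981_partialPairL_* (2.1)–(2.3)) and on an
Artin-formalism identity of Euler factors for induced Satake data; a slip in the slope bookkeeping
would need in-strip information the tree does not have.) [JacquetShalikaAJM1981II,
JacquetShalikaAJM1981, ArthurClozelAMS120, Ramakrishnan2000, BuzzardGeeLMS2014]
#9 CMFreeQuadraticPatch (support) — reciprocity over all finite extensions of imaginary quadratic
fields + canonical reciprocity data everywhere ⇒ `Langlands`. For F with no imaginary quadratic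
subfield: every finite place v of F splits in E_K = F·K for a suitable imaginary quadratic K; (A)_F
by quadratic base change of π to the E_K (Arthur–Clozel III.4.2/5.1), Galois invariance, and
patching of the ρ_(BC π) over varying K (Blasius–Rogawski / Sorensen patching as in
Chenevier–Harris, HLTT), local-global compatibility read at a K splitting v; (B)_F by quadratic
descent of the π attached to ρ|Γ_(E_K) plus (A)_F to fix the twist, avoiding the finitely many K
with ρ ≅ ρ ⊗ ε_K. [deps: AnchorAssembly, CanonicalReciprocityData] [difficulty: L] (why it might
fail: Needs STRONG quadratic base change/descent for all cuspidal π on GL_n (AC Thm III.4.2,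
III.5.1; named facts not yet vendored) and a patching lemma over infinitely many quadratic E_K/F;
the dihedral case π ≅ π ⊗ ε_K and 2-torsion sign choices must be tracked field by field.)
[ArthurClozelAMS120, ChenevierHarris2013, BlasiusRogawski1993, HarrisLanTaylorThorneRMS2016,
BarnetlambEtAl2014]

TWO-LAYER PLAN. Foreseen glued splits (nothing filed now): WeakAutomorphicInduction ⇐
ExistsInducedFamily (weak AI with cuspidal constituents, no slope /
algebraicity clause) → SlopeAndAlgebraicityTransfer → WeakAutomorphicInduction; RelativeDescent ⇐
WeakRelativeDescent (a.e. Satake only) →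
WeakToStrongOverL (local-global compatibility from a.e. compatibility for cuspidal π and irreducible
geometric ρ) → RelativeDescent;
ReciprocityImagQuad ⇐ AutToGalImagQuad → GalToAutImagQuad → ReciprocityImagQuad (k ≤ 3, depth 1
each).

KILL CRITERIA. A refutation of WeakAutomorphicInduction as typed (e.g. an L-algebraic cuspidal π
over some L ⊃ K whose weak induction to K exists but
is NOT equal-slope, or is not L-algebraic) forces a restatement of the slope clause (pivot: move the
slope claim into AnchorAssembly via
purity of geometric determinants); a refutation of its EXISTENCE part for a non-solvable L/K refutes
the line outright (close
refuted:WeakAutomorphicInduction). A refutation of RelativeDescent closes the route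
(refuted:RelativeDescent) — there is no descent-free
variant. ReciprocityImagQuad is a special case of the summit: its refutation refutes `Langlands`. If
TwistAveragedDeinduction closes
WeakInductionToQ AND TwistAverageExtraction, this route is superseded for direction (A) and keeps
only (B) via RelativeDescent.

NOT DECOMPOSED YET. The converse-theorem route to X2 (analytic package of L(s, π × BC(τ)) for τ on
GL_m/K), the Galois/solvable sub-cases of X2 and X3
(cyclic prime degree is Arthur–Clozel Thm 6.2 / 4.2 and is the BC5 rung), the weak-to-strong upgrade
inside X3, the patching lemma
and the dihedral case inside CMFreeQuadraticPatch, and every constituent of X1 (left to the CM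
programme; residual) — all layer-2.

CHEAPEST FALSIFIER. n = 1, [L:K] = 3 non-normal cubic (S_3-closure): X2 must produce, for an
algebraic Hecke character χ of L, an equal-slope family of
L-algebraic cuspidals on GL_1, GL_2 (or GL_3) over K inducing χ — this is JPSS 1979/1981 (non-normal
cubic induction) + Arthur–Clozel;
check that the equal-slope and L-algebraicity clauses hold THERE exactly as typed (a half-integer
shift in the C- vs L-normalisation of
AI would falsify the clause as written and force `IsLAlgebraic` ↦ a twist). Second: the r = 0 / m_i
= 0 / n = 0 degenerate instances are
excluded by the guards `0 < n`, `0 < m i` and `HasSatakeParamAt.card_eq` (negatives lesson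
stmt-Langlands-17212).

NUMBERS. Items at open: 7 (3 cruxes, 3 supports, 1 assembly); closes binders: 6. Anchor class: [K:ℚ]
= 2, totally complex (9 fields of class
number one, infinitely many in all); defect l₀ = n − 1 for GL_n over imaginary quadratic K (= 1 for
GL_2;
Calegari–Geraghty regime). Known rungs of X2/X3: [L:K] cyclic of prime degree (ArthurClozelAMS120
Thm III.6.2, III.4.2), solvable towers by iteration,
non-normal cubic for n = 1 (JPSS). Nothing non-solvable is known for n[L:K] ≥ 4 except via potential
automorphy over CM fields.

DEFINITION REQUESTS. None: every notion is in the tree (CuspidalAutomorphicRepData,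
HasSatakeParamAt, satakePolynomial, IsLAlgebraic, FramedGaloisRep,
restrictField, FramedGaloisRep.blockSum, FramedRep.reindex/conj, IsGeometricFramed, Corresponds,
ReciprocityData). Facts the supports
will want vendored (cite items, filed by their provers): Arthur–Clozel III.4.2/III.5.1 strong
quadratic base change and descent;
Blasius–Rogawski/Sorensen patching lemma.

Novelty: Searches (2026-08-17): `lit search --hybrid "nonsolvable base change automorphic induction GL(n)"`
(8 docs: ArthurClozel AMS120 pp 7–8,189;
Getz–Hahn GTM300 pp 275–278 "the theory of base change for nonsolvable extensions is unavailable";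
Harris–Taylor AM151); `lit vsearch
"automorphic induction from an arbitrary non-Galois extension … open beyond the solvable case"` (6
docs, same three on top); `lit search
--hybrid "converse theorem automorphic induction non-normal cubic"` (Bump p.100, Getz–Hahn p.277,
Gelbart–de Shalit p.248); `lit search
"Sorensen patching lemma Galois representations"` (corpus: arXiv:1411.6717 p.106,
doi:10.4310/cjm.2013.v1.n1.a2 p.20, arXiv:1306.1242 p.3);
`lit galaxy search "nonsolvable base change|non-solvable base change|nonsolvable descent" --star
all` (0 rows); `lit galaxy search
"solvable base change|automorphic induction" --star all` (16 rows: panama:220314642415712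
Harris–Taylor, panama:499951373123659 Automorphic
Forms and Galois Representations vol. 1, panama:506015866945592 Cornell–Silverman–Stevens); `ledger
negatives --problem Langlands` (4, none
of this shape); tree: Theses/TwistAveragedDeinduction, BaseFieldAscent, LiftDescend,
MonomialConverse, SplitPrimeInduction, SelfDefeatingInduction.
Nearest prior art found: Getz2012Nonsolvable + GetzHerman2015 (an approach to non-solvable base
change/descent for specific groups via
trace identities); ChenevierHarris2013 and HarrisLanTaylorThorneRMS2016 (Galois representations over
totally real/CM-fr  [refs: 10.4310/cjm.2013.v1.n1.a2, 1411.6717, 1306.1242, doi:10.4310/cjm.2013.v1.n1.a2, GetzHerman2015, ChenevierHarris2013, HarrisLanTaylorThorneRMS2016]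

Barriers (technique_class: automorphic-induction, relative-descent, RS-poles, patching): - technique_class: automorphic-induction, relative-descent, RS-poles, patching
- Literature.Barriers.Langlands.SolvableImageBarrier: X2/X3 sit OUTSIDE its technique class as
statements — they quantify over insoluble L/K, so no chain of cyclic/solvable base-change steps (the
class the barrier blocks) can prove them and none is proposed; the openings are the barrier's own
scope_caveats (no impossibility theorem for trace-formula or converse-theorem methods on insoluble
extensions: Getz2012Nonsolvable, CogdellPiatetskishapiro1999) and the fact that X3 is RELATIVE
(automorphy over K of all Ind-constituents is an input, supplied by (B)_K).
- Literature.Barriers.Langlands.SolvableImageBarrierNarrow: same placement; the cyclic-prime-degree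
rung (Arthur–Clozel 6.2/4.2) is inside the barrier and is only the BC5 witness, not the route.
- Literature.Barriers.Langlands.SolvableImageBarrierNarrowInduction: X2/X3 are NOT chains of base
change / restriction / AI along sub-solvable layers with Brauer induction (the exact class it
blocks, incl. the A₅ Brauer bookkeeping of conjuncts (1)–(5)); they are single-step statements along
an arbitrary L/K whose proof must come from outside that class (converse theorems fed by BC_(L/K),
nonsolvable trace identities, or Galois-side Ind + (B)_K); the barrier's own `NOT blocked (i)` list
(non-normal induction, converse theorems) is where the line lives; the bet is that such a tool
exists for insoluble L/K.
- Literature.Barriers.Langlands.ShimuraVarietyRea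

sub-problem: Langlands · status: draft · opened planner-type-573875563d-0 2026-08-17T16:20:55Z · rev 0 · ledger route-Langlands-ImaginaryQuadraticAnchor
GENERATED by the gate from the ledger (D-0016/17). Provers cite these decls: `theorem foo : Summit.Langlands.Langlands.Theses.ImaginaryQuadraticAnchor.<Decl> := …` in Summits/Langlands/Langlands/Theorems/<Name>.lean.
-/

namespace Summit.Langlands.Langlands.Theses.ImaginaryQuadraticAnchor

open scoped BigOperators Topology Manifold Classical MeasureTheory ProbabilityTheory Matrix InnerProductSpace ComplexConjugate ContinuousMap
open Filter Set Function TopologicalSpace MeasureTheory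

attribute [summit_statement] _root_.Langlands

/-- item stmt-Langlands-18735 · crux · rank 2 · open · by planner
why it might fail: For L/K with insoluble Galois closure this is non-solvable automorphic induction, open since 1989; a converse-theorem proof needs twists by BC_(L/K)(τ) for all cuspidal τ on GL_m/K, m < n[L:K], i.e. non-solvable base change as input.
sources: ArthurClozelAMS120, Getz2012Nonsolvable, GetzHerman2015, CogdellPiatetskishapiro1999, JPSS1983, Rajan1999
[crux] K imaginary quadratic, L ⊃ K any finite extension, π an L-algebraic cuspidal representation
of GL_n(𝔸_L), n ≥ 1: there are L-algebraic cuspidal P_1..P_r on GL_(m_i)(𝔸_K) (m_i ≥ 1), all of the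
same real slope σ as π (‖∏ Satake‖ = q^(mσ) a.e.), whose sum of Satake polynomials at a.e. w equals
∏_(v|w) SatPoly(π_v)(X^f(v|w)) (weak automorphic induction, Arthur–Clozel Def. 6.1 shape, along a
possibly NON-SOLVABLE L/K). First rung PROVED in the birth skeleton: the cyclic prime-degree case
off the Galois-stable locus, conclusion truncated to existence + Satake identity, from the vendored
fact automorphicInduction_cyclic_cuspidal (`WeakAutomorphicInduction_rung`); the
L-algebraicity/slope remainder of that case is the plan-only stub `stub_cyclicPrimeCase`.
[difficulty: open-problem] -/
@[route_item "route-Langlands-ImaginaryQuadraticAnchor", crux]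
def WeakAutomorphicInduction : Prop :=
  ∀ (K L : Type) [Field K] [NumberField K] [Field L] [NumberField L] [Algebra K L], NumberField.IsTotallyComplex K → Module.finrank ℚ K = 2 → ∀ (n : ℕ), 0 < n → ∀ (hL : Literature.NumberTheory.Automorphic.isCompact_glFiniteIntegralLevel n L) (π : Literature.NumberTheory.Automorphic.CuspidalAutomorphicRepData n L hL), π.1.IsLAlgebraic → ∃ (r : ℕ) (m : Fin r → ℕ) (hK : ∀ i, Literature.NumberTheory.Automorphic.isCompact_glFiniteIntegralLevel (m i) K) (P : ∀ i, Literature.NumberTheory.Automorphic.CuspidalAutomorphicRepData (m i) K (hK i)), (∀ i, 0 < m i ∧ (P i).1.IsLAlgebraic) ∧ (∃ σ : ℝ, (∀ᶠ v : IsDedekindDomain.HeightOneSpectrum (NumberField.RingOfIntegers L) in cofinite, ∀ β : Multiset ℂ, π.1.HasSatakeParamAt v β → ‖β.prod‖ = (v.residueCard : ℝ) ^ ((n : ℝ) * σ)) ∧ ∀ i, ∀ᶠ w : IsDedekindDomain.HeightOneSpectrum (NumberField.RingOfIntegers K) in cofinite, ∀ α : Multiset ℂ, (P i).1.HasSatakeParamAt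 w α → ‖α.prod‖ = (w.residueCard : ℝ) ^ ((m i : ℝ) * σ)) ∧ ∀ᶠ w : IsDedekindDomain.HeightOneSpectrum (NumberField.RingOfIntegers K) in cofinite, ∀ β : IsDedekindDomain.HeightOneSpectrum (NumberField.RingOfIntegers L) → Multiset ℂ, (∀ v : IsDedekindDomain.HeightOneSpectrum (NumberField.RingOfIntegers L), v.asIdeal.under (NumberField.RingOfIntegers K) = w.asIdeal → π.1.HasSatakeParamAt v (β v)) → ∃ α : Fin r → Multiset ℂ, (∀ i, (P i).1.HasSatakeParamAt w (α i)) ∧ Literature.NumberTheory.Automorphic.satakePolynomial (Finset.univ.sum α) = ∏ᶠ v ∈ {v : IsDedekindDomain.HeightOneSpectrum (NumberField.RingOfIntegers L) | v.asIdeal.under (NumberField.RingOfIntegers K) = w.asIdeal}, (Literature.NumberTheory.Automorphic.satakePolynomial (β v)).comp (Polynomial.X ^ v.asIdeal.inertiaDeg (NumberField.RingOfIntegers K))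

/-- item stmt-Langlands-18736 · crux · rank 3 · open · by planner
why it might fail: It is non-solvable base change K → L of the Galois-attached cuspidals Π plus Clifford extraction of one constituent; for insoluble L/K no trace-formula comparison is available and the local-global clause at places of L over ramified w must be descended too.
sources: ArthurClozelAMS120, Getz2012Nonsolvable, HarrisTaylor2001, HenniartInventiones2000, BarnetlambEtAl2014, BrinonConrad2009
[crux] K imaginary quadratic, L ⊃ K finite, ρ : Γ_L → GL_n(ℚ̄_ℓ) irreducible and geometric (w.r.t.
reciprocity data RL): if every irreducible geometric σ : Γ_K → GL_m(ℚ̄_ℓ) such that ρ is a block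
summand of σ|Γ_L (equivalently σ ⊂ Ind ρ) corresponds (full local-global compatibility, data RK) to
an L-algebraic cuspidal Π on GL_m(𝔸_K), then ρ corresponds to an L-algebraic cuspidal π on
GL_n(𝔸_L). (Only GEOMETRIC σ are assumed automorphic, so the prover also supplies the standard fact
that constituents of Ind ρ are de Rham, Fontaine/Brinon–Conrad; the hypothesis family is non-vacuous
by Frobenius reciprocity + semisimplicity of finite-index restrictions in characteristic 0.)
[difficulty: open-problem] -/
@[route_item "route-Langlands-ImaginaryQuadraticAnchor", crux]
def RelativeDescent : Prop :=
  ∀ (K L : Type) [Field K] [NumberField K] [Field L] [NumberField L] [Algebra K L], NumberField.IsTotallyComplex K → Module.finrank ℚ K = 2 → ∀ (n : ℕ), 0 < n → ∀ (hL : Literature.NumberTheory.Automorphic.isCompact_glFiniteIntegralLevel n L) (RL : Summit.Langlands.ReciprocityData L) (RK : Summit.Langlands.ReciprocityData K) (ℓ : ℕ) [Fact ℓ.Prime] (ι : PadicAlgCl ℓ ≃+* ℂ) (ρ : Literature.NumberTheory.GaloisRepresentations.FramedGaloisRep L (PadicAlgCl ℓ) n), ρ.toGaloisRep.IsIrreducible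 → Summit.Langlands.IsGeometricFramed RL ρ → (∀ (m : ℕ), 0 < m → ∀ (hK : Literature.NumberTheory.Automorphic.isCompact_glFiniteIntegralLevel m K) (σ : Literature.NumberTheory.GaloisRepresentations.FramedGaloisRep K (PadicAlgCl ℓ) m), σ.toGaloisRep.IsIrreducible → Summit.Langlands.IsGeometricFramed RK σ → (∃ (m' : ℕ) (τ : Literature.NumberTheory.GaloisRepresentations.FramedGaloisRep L (PadicAlgCl ℓ) m') (e : Fin (n + m') ≃ Fin m) (g : Matrix.GeneralLinearGroup (Fin m) (PadicAlgCl ℓ)), Literature.NumberTheory.GaloisRepresentations.FramedRep.conj g (σ.restrictField L) = Literature.NumberTheory.GaloisRepresentations.FramedRep.reindex e (Literature.NumberTheory.GaloisRepresentations.FramedGaloisRep.blockSum ρ τ)) → ∃ P : Literature.NumberTheory.Automorphic.CuspidalAutomorphicRepData m K hK, P.1.IsLAlgebraic ∧ Summit.Langlands.Corresponds RK ι P.1 σ) → ∃ π : Literature.NumberTheory.Automorphic.CuspidalAutomorphicRepData n L hL, π.1.IsLAlgebraic ∧ Summit.Langlands.Corresponds RL ι π.1 ρ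

/-- item stmt-Langlands-18737 · crux · rank 4 · open · by planner
why it might fail: It is the summit over imaginary quadratic fields: (A) needs Galois representations for NON-regular (Maass-type, λ=1/4) L-algebraic π over K with full monodromy in local-global compatibility; (B) needs automorphy of every irreducible geometric ρ, incl. residually reducible / Hodge-irregular ones.
sources: Scholze2015, HarrisLanTaylorThorneRMS2016, ACCGHLNSTT2023, CaraianiNewton2023, BuzzardGeeLMS2014, CalegariGeraghty2017
[crux] GL_n reciprocity (both directions (A) and (B) of the summit statement, verbatim, for every
reciprocity datum) over every imaginary quadratic field K — the declared RESIDUAL of the route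
(special case of the summit; the conjunct NOT attacked here). [difficulty: open-problem] -/
@[route_item "route-Langlands-ImaginaryQuadraticAnchor", crux]
def ReciprocityImagQuad : Prop :=
  ∀ (K : Type) [Field K] [NumberField K], NumberField.IsTotallyComplex K → Module.finrank ℚ K = 2 → ∀ (Rec : Summit.Langlands.ReciprocityData K) (n : ℕ), 0 < n → ∀ hcpt : Literature.NumberTheory.Automorphic.isCompact_glFiniteIntegralLevel n K, Summit.Langlands.GlobalLanglandsCorrespondenceGLn n K Rec hcpt

/-- item stmt-Langlands-17930 · support · rank 9 · open · by planner
why it might fail: In print (Harris–Taylor, Henniart; Fontaine) but in the tree only the cite-level `LocalLanglandsDatum.nonempty` with SOME Artin normalisation; canonicity needs the finite-level reciprocity law for that datum.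
sources: HarrisTaylor2001, HenniartInventiones2000, BuzzardGeeLMS2014
[support] THE SUMMIT'S NON-VACUITY CONJUNCT, verbatim (statement revision p141787, 2026-08-17:
`Langlands := ∀ F, Nonempty (ReciprocityData F) ∧ ∀ 𝓡 n, 0 < n → ∀ hcpt, GLC n F 𝓡 hcpt`, with
`ReciprocityData` pinned to THE local Artin maps by `llc_isCanonical` / `llc_eps_isCanonical`),
filed by route-repair 5a1bd9af as the explicit INPUT of this route's `∃ RD`-shaped slices
(LiftB2Unram, LiftB2UnramSmallF, LiftB2UnramLargeF, LiftB2UnramSplitP): for every number field F and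
every finite place v, a local Langlands datum for GL_n(F_v) (Harris–Taylor 2001 Thm A; Henniart 2000
Thm 1.2) normalised against THE local Artin map `canonicalArtin (F_v)`, whose ε-system (Deligne 1973
Thm 4.1) is normalised against the canonical Artin map of every finite E/F_v. IN PRINT,
textbook-grade input (Harris–Taylor's Thm A is stated relative to Art_K of local class field
theory); in the TREE not yet derivable — `LocalLanglandsDatum.nonempty` (cite-only) yields a datum
with SOME lawful Artin normalisation, and canonicity needs `IsLocalArtinMap.unique` + the
finite-level reciprocity law for that datum's Artin maps, or canonical variants of
`localLanglands_gl` / `nonempty_localEpsilonSystem` (needs-fact for -/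
@[route_item "route-Langlands-ImaginaryQuadraticAnchor", crux]
def CanonicalReciprocityData : Prop :=
  ∀ (F : Type) [Field F] [NumberField F], Nonempty (Summit.Langlands.ReciprocityData F)

/-- item stmt-Langlands-18738 · support · rank 9 · open · by planner
why it might fail: Long formal junction resting on vendored-but-unproved analytic facts (JacquetShalika1981_partialPairL_* (2.1)–(2.3)) and on an Artin-formalism identity of Euler factors for induced Satake data; a slip in the slope bookkeeping would need in-strip information the tree does not have.
sources: JacquetShalikaAJM1981II, JacquetShalikaAJM1981, ArthurClozelAMS120, Ramakrishnan2000, BuzzardGeeLMS2014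
[support] X1 → X2 → X3 → CanonicalReciprocityData → reciprocity (both directions, every datum, every
n ≥ 1) over every finite extension L of an imaginary quadratic K (the canonical data supply the
reciprocity datum over K that X1/X3 are instantiated at). Theorem-level junction: (B)_L = X3 fed by
(B)_K; (A)_L: X2(π) gives P_i, (A)_K gives R = ⊞ ρ_(P_i), the constituents σ_j of R|Γ_L are
geometric (DeRhamBaseChange_holds, isDeRhamFramed_blocks), X3 gives π_j ↔ σ_j, a second application
of X2 to the π_j and the Jacquet–Shalika boundary facts (2.2)–(2.3) force all slopes equal and then
∏_i L^S(s, P_i × P̃_i') = ∏_j L^S(s, π × π̃_j) has a pole at s = 1, so π ≅ π_j for some j (strong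
multiplicity one) and ρ_π := σ_j; uniqueness by Chebotarev + Brauer–Nesbitt. [deps:
ReciprocityImagQuad, WeakAutomorphicInduction, RelativeDescent, CanonicalReciprocityData]
[difficulty: L] -/
@[route_item "route-Langlands-ImaginaryQuadraticAnchor", crux]
def AnchorAssembly : Prop :=
  ReciprocityImagQuad → WeakAutomorphicInduction → RelativeDescent → CanonicalReciprocityData → ∀ (K L : Type) [Field K] [NumberField K] [Field L] [NumberField L] [Algebra K L], NumberField.IsTotallyComplex K → Module.finrank ℚ K = 2 → ∀ (Rec : Summit.Langlands.ReciprocityData L) (n : ℕ), 0 < n → ∀ hcpt : Literature.NumberTheory.Automorphic.isCompact_glFiniteIntegralLevel n L, Summit.Langlands.GlobalLanglandsCorrespondenceGLn n L Rec hcpt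

/-- item stmt-Langlands-18739 · support · rank 9 · open · by planner
why it might fail: Needs STRONG quadratic base change/descent for all cuspidal π on GL_n (AC Thm III.4.2, III.5.1; named facts not yet vendored) and a patching lemma over infinitely many quadratic E_K/F; the dihedral case π ≅ π ⊗ ε_K and 2-torsion sign choices must be tracked field by field.
sources: ArthurClozelAMS120, ChenevierHarris2013, BlasiusRogawski1993, HarrisLanTaylorThorneRMS2016, BarnetlambEtAl2014
[support] reciprocity over all finite extensions of imaginary quadratic fields + canonical
reciprocity data everywhere ⇒ `Langlands`. For F with no imaginary quadratic subfield: every finite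
place v of F splits in E_K = F·K for a suitable imaginary quadratic K; (A)_F by quadratic base
change of π to the E_K (Arthur–Clozel III.4.2/5.1), Galois invariance, and patching of the ρ_(BC π)
over varying K (Blasius–Rogawski / Sorensen patching as in Chenevier–Harris, HLTT), local-global
compatibility read at a K splitting v; (B)_F by quadratic descent of the π attached to ρ|Γ_(E_K)
plus (A)_F to fix the twist, avoiding the finitely many K with ρ ≅ ρ ⊗ ε_K. [deps: AnchorAssembly,
CanonicalReciprocityData] [difficulty: L] -/
@[route_item "route-Langlands-ImaginaryQuadraticAnchor", crux]
def CMFreeQuadraticPatch : Prop :=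
  (∀ (K L : Type) [Field K] [NumberField K] [Field L] [NumberField L] [Algebra K L], NumberField.IsTotallyComplex K → Module.finrank ℚ K = 2 → ∀ (Rec : Summit.Langlands.ReciprocityData L) (n : ℕ), 0 < n → ∀ hcpt : Literature.NumberTheory.Automorphic.isCompact_glFiniteIntegralLevel n L, Summit.Langlands.GlobalLanglandsCorrespondenceGLn n L Rec hcpt) → CanonicalReciprocityData → _root_.Langlands

/-- item stmt-Langlands-18747 · assembly · rank 1 · closed · proved by Summit.Langlands.Langlands.Theorems.imaginaryQuadraticAnchor_assembly_proof (prover) · by planner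
sources: BuzzardGeeLMS2014, ArthurClozelAMS120
[assembly] ReciprocityImagQuad → WeakAutomorphicInduction → RelativeDescent →
CanonicalReciprocityData → AnchorAssembly → CMFreeQuadraticPatch → Langlands. -/
@[route_item "route-Langlands-ImaginaryQuadraticAnchor"]
def Assembly : Prop :=
  ReciprocityImagQuad → WeakAutomorphicInduction → RelativeDescent → CanonicalReciprocityData → AnchorAssembly → CMFreeQuadraticPatch → _root_.Langlands

-- `Assembly` holds: proved by `Summit.Langlands.Langlands.Theorems.imaginaryQuadraticAnchor_assembly_proof` (its module imports this route file, so no `_holds` link can be stated here).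

/-! D-0027 §2.1 — DECIDING THEOREM (planner-authored via `route open/edit --closes-file`; by planner-type-573875563d-0 2026-08-17T16:20:55Z):
its hypotheses are this route's items and its conclusion the sub-problem Statement (glue_lint), and it elaborates with this file. -/

@[closes "route-Langlands-ImaginaryQuadraticAnchor"] theorem closes (h1 : ReciprocityImagQuad) (h2 : WeakAutomorphicInduction) (h3 : RelativeDescent)
    (hC : CanonicalReciprocityData) (hA : AnchorAssembly) (h0 : CMFreeQuadraticPatch) :
    _root_.Langlands :=
  h0 (hA h1 h2 h3 hC) hC

end Summit.Langlands.Langlands.Theses.ImaginaryQuadraticAnchor
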